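import Literature.NumberTheory.DiophantineGeometry.AbcExceptionalSetDivisorCounting
import Literature.NumberTheory.DiophantineGeometry.AbcExceptionalSetLattice
import HarnessLib

/-!
# Moment and lattice bounds for the shape map `F(x₁, x₂, x₃, x₄, r) = x₁ x₂² x₃³ x₄⁴ r`

Topic `NumberTheory/DiophantineGeometry`; auxiliary file for the proof of
`Literature.NumberTheory.DiophantineGeometry.bernertEtAl2024_thm_1_2`
(Bernert–Browning–Lichtman–Teräväinen, arXiv:2410.12234 v2, Theorem 1.2), assembled in
`AbcExceptionalSetBoundsThm12Proofs`. Here the abstract inequalities of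
`AbcExceptionalSetEnergy`, `AbcExceptionalSetDivisorCounting` and `AbcExceptionalSetLattice` are
specialised to the five-variable shape map on product finsets
`𝒳 = A₁ × A₂ × A₃ × A₄ × R ⊆ ℕ⁵` (the map `F` is passed as a variable together with its defining
equation `hF`, so that no definition is introduced):

* `card_solutions_pow_six_shape_le` — the "Fourier bound" [cite: Bernert2025, Prop. 3]: for
  `j = 2, 3, 4`, `#A_j #B_j #C_j · T⁶ ≤ 27 τ_max³⁰ (#𝒳 #𝒴 #𝒵)⁴`, where `T = #{F x + F y = F z}`
  and `τ_max` bounds `τ(m)` for `m` up to the largest value of `F`;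
* `card_coprimeSolutions_le` — the "geometry bound" [cite: Bernert2025, Prop. 2]: with dyadic
  first coordinates `A₁ = [X₁, 2X₁)` etc., the number of solutions of `F x + F y = F z` with
  `gcd(F x, F y) = 1` and `F z ≥ C` is at most `#K_X #K_Y #K_Z (1 + 16 X₁Y₁Z₁/C)`,
  `K_X = A₂ × A₃ × A₄ × R`.
-/

open Finset

namespace Literature.NumberTheory.DiophantineGeometry

namespace AbcExceptional

/-! ### Divisor counting for tuples -/

/-- If every coordinate of `k ∈ ℕ⁴` divides `Q k`, then `#{k ∈ K : Q k ∣ m} ≤ τ(m)⁴` (`m ≠ 0`).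
[folklore] -/
theorem card_filter_dvd_le_pow_four (Kf : Finset (ℕ × ℕ × ℕ × ℕ)) (Q : ℕ × ℕ × ℕ × ℕ → ℕ)
    (hQ : ∀ k, k.1 ∣ Q k ∧ k.2.1 ∣ Q k ∧ k.2.2.1 ∣ Q k ∧ k.2.2.2 ∣ Q k) {m : ℕ} (hm : m ≠ 0) :
    #{k ∈ Kf | Q k ∣ m} ≤ #m.divisors ^ 4 := by
  calc #{k ∈ Kf | Q k ∣ m} ≤ #(m.divisors ×ˢ m.divisors ×ˢ m.divisors ×ˢ m.divisors) := by
        refine card_le_card (fun k hk => ?_)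
        obtain ⟨-, hdiv⟩ := mem_filter.mp hk
        obtain ⟨h1, h2, h3, h4⟩ := hQ k
        simp only [mem_product, Nat.mem_divisors]
        exact ⟨⟨h1.trans hdiv, hm⟩, ⟨h2.trans hdiv, hm⟩, ⟨h3.trans hdiv, hm⟩, ⟨h4.trans hdiv, hm⟩⟩
    _ = #m.divisors ^ 4 := by simp only [card_product]; ring

/-- If every coordinate of `x ∈ ℕ⁵` divides `F x`, then `#{x ∈ 𝒳 : F x = n} ≤ τ(n)⁵` (`n ≠ 0`).
[folklore] -/
theorem card_filter_eq_le_pow_five (𝒳 : Finset (ℕ × ℕ × ℕ × ℕ × ℕ))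
    (F : ℕ × ℕ × ℕ × ℕ × ℕ → ℕ)
    (hF : ∀ x, x.1 ∣ F x ∧ x.2.1 ∣ F x ∧ x.2.2.1 ∣ F x ∧ x.2.2.2.1 ∣ F x ∧ x.2.2.2.2 ∣ F x)
    {n : ℕ} (hn : n ≠ 0) : #{x ∈ 𝒳 | F x = n} ≤ #n.divisors ^ 5 := by
  calc #{x ∈ 𝒳 | F x = n}
      ≤ #(n.divisors ×ˢ n.divisors ×ˢ n.divisors ×ˢ n.divisors ×ˢ n.divisors) := by
        refine card_le_card (fun x hx => ?_)
        obtain ⟨-, hFx⟩ := mem_filter.mp hx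
        obtain ⟨h1, h2, h3, h4, h5⟩ := hF x
        rw [hFx] at h1 h2 h3 h4 h5
        simp only [mem_product, Nat.mem_divisors]
        exact ⟨⟨h1, hn⟩, ⟨h2, hn⟩, ⟨h3, hn⟩, ⟨h4, hn⟩, ⟨h5, hn⟩⟩
    _ = #n.divisors ^ 5 := by simp only [card_product]; ring

/-- The coordinates of `x` divide `F x = x₁ x₂² x₃³ x₄⁴ r`. [folklore] -/
theorem dvd_shape (F : ℕ × ℕ × ℕ × ℕ × ℕ → ℕ)
    (hF : ∀ x, F x = x.1 * x.2.1 ^ 2 * x.2.2.1 ^ 3 * x.2.2.2.1 ^ 4 * x.2.2.2.2)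
    (x : ℕ × ℕ × ℕ × ℕ × ℕ) :
    x.1 ∣ F x ∧ x.2.1 ∣ F x ∧ x.2.2.1 ∣ F x ∧ x.2.2.2.1 ∣ F x ∧ x.2.2.2.2 ∣ F x := by
  rw [hF x]
  refine ⟨⟨x.2.1 ^ 2 * x.2.2.1 ^ 3 * x.2.2.2.1 ^ 4 * x.2.2.2.2, by ring⟩,
    ⟨x.1 * x.2.1 * x.2.2.1 ^ 3 * x.2.2.2.1 ^ 4 * x.2.2.2.2, by ring⟩,
    ⟨x.1 * x.2.1 ^ 2 * x.2.2.1 ^ 2 * x.2.2.2.1 ^ 4 * x.2.2.2.2, by ring⟩,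
    ⟨x.1 * x.2.1 ^ 2 * x.2.2.1 ^ 3 * x.2.2.2.1 ^ 3 * x.2.2.2.2, by ring⟩,
    ⟨x.1 * x.2.1 ^ 2 * x.2.2.1 ^ 3 * x.2.2.2.1 ^ 4, by ring⟩⟩

/-! ### Second and fourth moments of the shape map -/

/-- `E₂ ≤ #𝒳 · τ_max⁵` for the shape map. [cite: Bernert2025, Prop. 3] -/
theorem card_E2_shape_le (𝒳 : Finset (ℕ × ℕ × ℕ × ℕ × ℕ)) (F : ℕ × ℕ × ℕ × ℕ × ℕ → ℕ)
    (hF : ∀ x, F x = x.1 * x.2.1 ^ 2 * x.2.2.1 ^ 3 * x.2.2.2.1 ^ 4 * x.2.2.2.2) (N Tm : ℕ)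
    (hpos : ∀ x ∈ 𝒳, 0 < F x) (hN : ∀ x ∈ 𝒳, F x ≤ N)
    (hτ : ∀ m : ℕ, 0 < m → m ≤ N → #(m.divisors) ≤ Tm) :
    #{p ∈ 𝒳 ×ˢ 𝒳 | (F p.1 : ℤ) = F p.2} ≤ #𝒳 * Tm ^ 5 := by
  refine card_E2_le 𝒳 (fun x => (F x : ℤ)) (Tm ^ 5) (fun x hx => ?_)
  have h1 : {x' ∈ 𝒳 | (F x' : ℤ) = (F x : ℤ)} = {x' ∈ 𝒳 | F x' = F x} :=
    filter_congr (fun x' _ => by exact_mod_cast Iff.rfl)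
  rw [h1]
  calc #{x' ∈ 𝒳 | F x' = F x} ≤ #(F x).divisors ^ 5 :=
        card_filter_eq_le_pow_five 𝒳 F (dvd_shape F hF) (hpos x hx).ne'
    _ ≤ Tm ^ 5 := Nat.pow_le_pow_left (hτ _ (hpos x hx) (hN x hx)) 5

/-- `#A₂ · E₄ ≤ #𝒳 (#𝒳 E₂ + #𝒳² · 2τ_max⁵)` for the shape map on `𝒳 = A₁ × A₂ × A₃ × A₄ × R`
(split off the quadratic variable `x₂`). [cite: Bernert2025, Prop. 3] -/
theorem card_E4_shape_le_two (A₁ A₂ A₃ A₄ R : Finset ℕ) (F : ℕ × ℕ × ℕ × ℕ × ℕ → ℕ)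
    (hF : ∀ x, F x = x.1 * x.2.1 ^ 2 * x.2.2.1 ^ 3 * x.2.2.2.1 ^ 4 * x.2.2.2.2) (N Tm : ℕ)
    (hpos : ∀ x ∈ A₁ ×ˢ A₂ ×ˢ A₃ ×ˢ A₄ ×ˢ R, 0 < F x)
    (hN : ∀ x ∈ A₁ ×ˢ A₂ ×ˢ A₃ ×ˢ A₄ ×ˢ R, F x ≤ N)
    (hτ : ∀ m : ℕ, 0 < m → m ≤ N → #(m.divisors) ≤ Tm) :
    #A₂ * #{q ∈ ((A₁ ×ˢ A₂ ×ˢ A₃ ×ˢ A₄ ×ˢ R) ×ˢ (A₁ ×ˢ A₂ ×ˢ A₃ ×ˢ A₄ ×ˢ R)) ×ˢ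
        ((A₁ ×ˢ A₂ ×ˢ A₃ ×ˢ A₄ ×ˢ R) ×ˢ (A₁ ×ˢ A₂ ×ˢ A₃ ×ˢ A₄ ×ˢ R)) |
        (F q.1.1 : ℤ) - F q.1.2 = (F q.2.1 : ℤ) - F q.2.2} ≤
      #(A₁ ×ˢ A₂ ×ˢ A₃ ×ˢ A₄ ×ˢ R) * (#(A₁ ×ˢ A₂ ×ˢ A₃ ×ˢ A₄ ×ˢ R) *
        #{p ∈ (A₁ ×ˢ A₂ ×ˢ A₃ ×ˢ A₄ ×ˢ R) ×ˢ (A₁ ×ˢ A₂ ×ˢ A₃ ×ˢ A₄ ×ˢ R) |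
          (F p.1 : ℤ) = F p.2} + #(A₁ ×ˢ A₂ ×ˢ A₃ ×ˢ A₄ ×ˢ R) ^ 2 * (2 * Tm ^ 5)) := by
  classical
  set 𝒳 := A₁ ×ˢ A₂ ×ˢ A₃ ×ˢ A₄ ×ˢ R with h𝒳
  have h := card_E4_le_keyed 𝒳 F (fun x => x.2.1) (fun x => (x.1, x.2.2.1, x.2.2.2.1, x.2.2.2.2))
    (fun k => k.1 * k.2.1 ^ 3 * k.2.2.1 ^ 4 * k.2.2.2) (A₁ ×ˢ A₃ ×ˢ A₄ ×ˢ R) (le_refl 2)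
    N (Tm ^ 4) Tm ?_ ?_ ?_ hpos hN ?_ hτ
  · have hcard : #A₂ * #(A₁ ×ˢ A₃ ×ˢ A₄ ×ˢ R) = #𝒳 := by
      simp only [h𝒳, card_product]; ring
    calc _ ≤ #A₂ * (#(A₁ ×ˢ A₃ ×ˢ A₄ ×ˢ R) * (#𝒳 * #{p ∈ 𝒳 ×ˢ 𝒳 | (F p.1 : ℤ) = F p.2} +
          #𝒳 ^ 2 * (Tm ^ 4 * (2 * Tm)))) := Nat.mul_le_mul_left _ h
      _ = #𝒳 * (#𝒳 * #{p ∈ 𝒳 ×ˢ 𝒳 | (F p.1 : ℤ) = F p.2} + #𝒳 ^ 2 * (2 * Tm ^ 5)) := by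
          rw [← mul_assoc, hcard]; ring
  · intro x _
    rw [hF]
    ring
  · intro x _ y _ hxy
    simp only [Prod.mk.injEq] at hxy
    obtain ⟨h2, h1, h3, h4, h5⟩ := hxy
    exact Prod.ext h1 (Prod.ext h2 (Prod.ext h3 (Prod.ext h4 h5)))
  · intro x hx
    simp only [h𝒳, mem_product] at hx ⊢
    exact ⟨hx.1, hx.2.2.1, hx.2.2.2.1, hx.2.2.2.2⟩
  · intro m hm hmN
    calc _ ≤ #m.divisors ^ 4 := card_filter_dvd_le_pow_four _ _ (fun k =>
          ⟨⟨k.2.1 ^ 3 * k.2.2.1 ^ 4 * k.2.2.2, by ring⟩,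
           ⟨k.1 * k.2.1 ^ 2 * k.2.2.1 ^ 4 * k.2.2.2, by ring⟩,
           ⟨k.1 * k.2.1 ^ 3 * k.2.2.1 ^ 3 * k.2.2.2, by ring⟩,
           ⟨k.1 * k.2.1 ^ 3 * k.2.2.1 ^ 4, by ring⟩⟩) hm.ne'
      _ ≤ Tm ^ 4 := Nat.pow_le_pow_left (hτ m hm hmN) 4

/-- `#A₃ · E₄ ≤ #𝒳 (#𝒳 E₂ + #𝒳² · 2τ_max⁵)` (split off the cubic variable `x₃`).
[cite: Bernert2025, Prop. 3] -/
theorem card_E4_shape_le_three (A₁ A₂ A₃ A₄ R : Finset ℕ) (F : ℕ × ℕ × ℕ × ℕ × ℕ → ℕ)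
    (hF : ∀ x, F x = x.1 * x.2.1 ^ 2 * x.2.2.1 ^ 3 * x.2.2.2.1 ^ 4 * x.2.2.2.2) (N Tm : ℕ)
    (hpos : ∀ x ∈ A₁ ×ˢ A₂ ×ˢ A₃ ×ˢ A₄ ×ˢ R, 0 < F x)
    (hN : ∀ x ∈ A₁ ×ˢ A₂ ×ˢ A₃ ×ˢ A₄ ×ˢ R, F x ≤ N)
    (hτ : ∀ m : ℕ, 0 < m → m ≤ N → #(m.divisors) ≤ Tm) :
    #A₃ * #{q ∈ ((A₁ ×ˢ A₂ ×ˢ A₃ ×ˢ A₄ ×ˢ R) ×ˢ (A₁ ×ˢ A₂ ×ˢ A₃ ×ˢ A₄ ×ˢ R)) ×ˢ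
        ((A₁ ×ˢ A₂ ×ˢ A₃ ×ˢ A₄ ×ˢ R) ×ˢ (A₁ ×ˢ A₂ ×ˢ A₃ ×ˢ A₄ ×ˢ R)) |
        (F q.1.1 : ℤ) - F q.1.2 = (F q.2.1 : ℤ) - F q.2.2} ≤
      #(A₁ ×ˢ A₂ ×ˢ A₃ ×ˢ A₄ ×ˢ R) * (#(A₁ ×ˢ A₂ ×ˢ A₃ ×ˢ A₄ ×ˢ R) *
        #{p ∈ (A₁ ×ˢ A₂ ×ˢ A₃ ×ˢ A₄ ×ˢ R) ×ˢ (A₁ ×ˢ A₂ ×ˢ A₃ ×ˢ A₄ ×ˢ R) |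
          (F p.1 : ℤ) = F p.2} + #(A₁ ×ˢ A₂ ×ˢ A₃ ×ˢ A₄ ×ˢ R) ^ 2 * (2 * Tm ^ 5)) := by
  classical
  set 𝒳 := A₁ ×ˢ A₂ ×ˢ A₃ ×ˢ A₄ ×ˢ R with h𝒳
  have h := card_E4_le_keyed (j := 3) 𝒳 F (fun x => x.2.2.1)
    (fun x => (x.1, x.2.1, x.2.2.2.1, x.2.2.2.2))
    (fun k => k.1 * k.2.1 ^ 2 * k.2.2.1 ^ 4 * k.2.2.2) (A₁ ×ˢ A₂ ×ˢ A₄ ×ˢ R) (by norm_num)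
    N (Tm ^ 4) Tm ?_ ?_ ?_ hpos hN ?_ hτ
  · have hcard : #A₃ * #(A₁ ×ˢ A₂ ×ˢ A₄ ×ˢ R) = #𝒳 := by
      simp only [h𝒳, card_product]; ring
    calc _ ≤ #A₃ * (#(A₁ ×ˢ A₂ ×ˢ A₄ ×ˢ R) * (#𝒳 * #{p ∈ 𝒳 ×ˢ 𝒳 | (F p.1 : ℤ) = F p.2} +
          #𝒳 ^ 2 * (Tm ^ 4 * (2 * Tm)))) := Nat.mul_le_mul_left _ h
      _ = #𝒳 * (#𝒳 * #{p ∈ 𝒳 ×ˢ 𝒳 | (F p.1 : ℤ) = F p.2} + #𝒳 ^ 2 * (2 * Tm ^ 5)) := by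
          rw [← mul_assoc, hcard]; ring
  · intro x _
    rw [hF]
    ring
  · intro x _ y _ hxy
    simp only [Prod.mk.injEq] at hxy
    obtain ⟨h3, h1, h2, h4, h5⟩ := hxy
    exact Prod.ext h1 (Prod.ext h2 (Prod.ext h3 (Prod.ext h4 h5)))
  · intro x hx
    simp only [h𝒳, mem_product] at hx ⊢
    exact ⟨hx.1, hx.2.1, hx.2.2.2.1, hx.2.2.2.2⟩
  · intro m hm hmN
    calc _ ≤ #m.divisors ^ 4 := card_filter_dvd_le_pow_four _ _ (fun k =>
          ⟨⟨k.2.1 ^ 2 * k.2.2.1 ^ 4 * k.2.2.2, by ring⟩,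
           ⟨k.1 * k.2.1 * k.2.2.1 ^ 4 * k.2.2.2, by ring⟩,
           ⟨k.1 * k.2.1 ^ 2 * k.2.2.1 ^ 3 * k.2.2.2, by ring⟩,
           ⟨k.1 * k.2.1 ^ 2 * k.2.2.1 ^ 4, by ring⟩⟩) hm.ne'
      _ ≤ Tm ^ 4 := Nat.pow_le_pow_left (hτ m hm hmN) 4

/-- `#A₄ · E₄ ≤ #𝒳 (#𝒳 E₂ + #𝒳² · 2τ_max⁵)` (split off the quartic variable `x₄`).
[cite: Bernert2025, Prop. 3] -/
theorem card_E4_shape_le_four (A₁ A₂ A₃ A₄ R : Finset ℕ) (F : ℕ × ℕ × ℕ × ℕ × ℕ → ℕ)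
    (hF : ∀ x, F x = x.1 * x.2.1 ^ 2 * x.2.2.1 ^ 3 * x.2.2.2.1 ^ 4 * x.2.2.2.2) (N Tm : ℕ)
    (hpos : ∀ x ∈ A₁ ×ˢ A₂ ×ˢ A₃ ×ˢ A₄ ×ˢ R, 0 < F x)
    (hN : ∀ x ∈ A₁ ×ˢ A₂ ×ˢ A₃ ×ˢ A₄ ×ˢ R, F x ≤ N)
    (hτ : ∀ m : ℕ, 0 < m → m ≤ N → #(m.divisors) ≤ Tm) :
    #A₄ * #{q ∈ ((A₁ ×ˢ A₂ ×ˢ A₃ ×ˢ A₄ ×ˢ R) ×ˢ (A₁ ×ˢ A₂ ×ˢ A₃ ×ˢ A₄ ×ˢ R)) ×ˢ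
        ((A₁ ×ˢ A₂ ×ˢ A₃ ×ˢ A₄ ×ˢ R) ×ˢ (A₁ ×ˢ A₂ ×ˢ A₃ ×ˢ A₄ ×ˢ R)) |
        (F q.1.1 : ℤ) - F q.1.2 = (F q.2.1 : ℤ) - F q.2.2} ≤
      #(A₁ ×ˢ A₂ ×ˢ A₃ ×ˢ A₄ ×ˢ R) * (#(A₁ ×ˢ A₂ ×ˢ A₃ ×ˢ A₄ ×ˢ R) *
        #{p ∈ (A₁ ×ˢ A₂ ×ˢ A₃ ×ˢ A₄ ×ˢ R) ×ˢ (A₁ ×ˢ A₂ ×ˢ A₃ ×ˢ A₄ ×ˢ R) |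
          (F p.1 : ℤ) = F p.2} + #(A₁ ×ˢ A₂ ×ˢ A₃ ×ˢ A₄ ×ˢ R) ^ 2 * (2 * Tm ^ 5)) := by
  classical
  set 𝒳 := A₁ ×ˢ A₂ ×ˢ A₃ ×ˢ A₄ ×ˢ R with h𝒳
  have h := card_E4_le_keyed (j := 4) 𝒳 F (fun x => x.2.2.2.1)
    (fun x => (x.1, x.2.1, x.2.2.1, x.2.2.2.2))
    (fun k => k.1 * k.2.1 ^ 2 * k.2.2.1 ^ 3 * k.2.2.2) (A₁ ×ˢ A₂ ×ˢ A₃ ×ˢ R) (by norm_num)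
    N (Tm ^ 4) Tm ?_ ?_ ?_ hpos hN ?_ hτ
  · have hcard : #A₄ * #(A₁ ×ˢ A₂ ×ˢ A₃ ×ˢ R) = #𝒳 := by
      simp only [h𝒳, card_product]; ring
    calc _ ≤ #A₄ * (#(A₁ ×ˢ A₂ ×ˢ A₃ ×ˢ R) * (#𝒳 * #{p ∈ 𝒳 ×ˢ 𝒳 | (F p.1 : ℤ) = F p.2} +
          #𝒳 ^ 2 * (Tm ^ 4 * (2 * Tm)))) := Nat.mul_le_mul_left _ h
      _ = #𝒳 * (#𝒳 * #{p ∈ 𝒳 ×ˢ 𝒳 | (F p.1 : ℤ) = F p.2} + #𝒳 ^ 2 * (2 * Tm ^ 5)) := by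
          rw [← mul_assoc, hcard]; ring
  · intro x _
    rw [hF]
    ring
  · intro x _ y _ hxy
    simp only [Prod.mk.injEq] at hxy
    obtain ⟨h4, h1, h2, h3, h5⟩ := hxy
    exact Prod.ext h1 (Prod.ext h2 (Prod.ext h3 (Prod.ext h4 h5)))
  · intro x hx
    simp only [h𝒳, mem_product] at hx ⊢
    exact ⟨hx.1, hx.2.1, hx.2.2.1, hx.2.2.2.2⟩
  · intro m hm hmN
    calc _ ≤ #m.divisors ^ 4 := card_filter_dvd_le_pow_four _ _ (fun k =>
          ⟨⟨k.2.1 ^ 2 * k.2.2.1 ^ 3 * k.2.2.2, by ring⟩,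
           ⟨k.1 * k.2.1 * k.2.2.1 ^ 3 * k.2.2.2, by ring⟩,
           ⟨k.1 * k.2.1 ^ 2 * k.2.2.1 ^ 2 * k.2.2.2, by ring⟩,
           ⟨k.1 * k.2.1 ^ 2 * k.2.2.1 ^ 3, by ring⟩⟩) hm.ne'
      _ ≤ Tm ^ 4 := Nat.pow_le_pow_left (hτ m hm hmN) 4

/-! ### The sixth-power bound for the shape map -/

/-- Algebra of the moment bounds: `T⁶ ≤ ∏ E₂ · ∏ E₄`, `E₂ ≤ n t`, `a E₄ ≤ n (n E₂ + 2 n² t)`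
give `a_x a_y a_z T⁶ ≤ 27 t⁶ (n_x n_y n_z)⁴`. [folklore] -/
theorem pow_six_le_of_moments {T E2x E2y E2z E4x E4y E4z nx ny nz ax ay az t : ℕ}
    (hT : T ^ 6 ≤ (E2x * E2y * E2z) * (E4x * E4y * E4z))
    (h2x : E2x ≤ nx * t) (h2y : E2y ≤ ny * t) (h2z : E2z ≤ nz * t)
    (h4x : ax * E4x ≤ nx * (nx * E2x + nx ^ 2 * (2 * t)))
    (h4y : ay * E4y ≤ ny * (ny * E2y + ny ^ 2 * (2 * t)))
    (h4z : az * E4z ≤ nz * (nz * E2z + nz ^ 2 * (2 * t))) :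
    ax * ay * az * T ^ 6 ≤ 27 * t ^ 6 * (nx * ny * nz) ^ 4 := by
  have g : ∀ {a E4 E2 n : ℕ}, E2 ≤ n * t → a * E4 ≤ n * (n * E2 + n ^ 2 * (2 * t)) →
      a * E4 ≤ 3 * t * n ^ 3 := by
    intro a E4 E2 n h2 h4
    calc a * E4 ≤ n * (n * E2 + n ^ 2 * (2 * t)) := h4
      _ ≤ n * (n * (n * t) + n ^ 2 * (2 * t)) :=
          Nat.mul_le_mul_left _ (Nat.add_le_add_right (Nat.mul_le_mul_left _ h2) _)
      _ = 3 * t * n ^ 3 := by ring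
  calc ax * ay * az * T ^ 6 ≤ ax * ay * az * ((E2x * E2y * E2z) * (E4x * E4y * E4z)) :=
        Nat.mul_le_mul_left _ hT
    _ = (E2x * E2y * E2z) * ((ax * E4x) * (ay * E4y) * (az * E4z)) := by ring
    _ ≤ (nx * t * (ny * t) * (nz * t)) *
          ((3 * t * nx ^ 3) * (3 * t * ny ^ 3) * (3 * t * nz ^ 3)) :=
        Nat.mul_le_mul (Nat.mul_le_mul (Nat.mul_le_mul h2x h2y) h2z)
          (Nat.mul_le_mul (Nat.mul_le_mul (g h2x h4x) (g h2y h4y)) (g h2z h4z))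
    _ = 27 * t ^ 6 * (nx * ny * nz) ^ 4 := by ring

/-- **Sixth-power ("Fourier") bound for the shape map**, `j = 2, 3, 4` at once: with
`𝒳 = A₁ × ⋯ × A₄ × R`, `𝒴 = B₁ × ⋯ × S`, `𝒵 = C₁ × ⋯ × U` and `T = #{F x + F y = F z}`,
`#A_j #B_j #C_j · T⁶ ≤ 27 τ_max³⁰ (#𝒳 #𝒴 #𝒵)⁴`, i.e. `T ≪ (#𝒳#𝒴#𝒵)^{2/3} / (#A_j#B_j#C_j)^{1/6}`.
[cite: Bernert2025, Prop. 3] -/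
theorem card_solutions_pow_six_shape_le (A₁ A₂ A₃ A₄ R B₁ B₂ B₃ B₄ S C₁ C₂ C₃ C₄ U : Finset ℕ)
    (F : ℕ × ℕ × ℕ × ℕ × ℕ → ℕ)
    (hF : ∀ x, F x = x.1 * x.2.1 ^ 2 * x.2.2.1 ^ 3 * x.2.2.2.1 ^ 4 * x.2.2.2.2) (N Tm : ℕ)
    (hposX : ∀ x ∈ A₁ ×ˢ A₂ ×ˢ A₃ ×ˢ A₄ ×ˢ R, 0 < F x)
    (hNX : ∀ x ∈ A₁ ×ˢ A₂ ×ˢ A₃ ×ˢ A₄ ×ˢ R, F x ≤ N)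
    (hposY : ∀ y ∈ B₁ ×ˢ B₂ ×ˢ B₃ ×ˢ B₄ ×ˢ S, 0 < F y)
    (hNY : ∀ y ∈ B₁ ×ˢ B₂ ×ˢ B₃ ×ˢ B₄ ×ˢ S, F y ≤ N)
    (hposZ : ∀ z ∈ C₁ ×ˢ C₂ ×ˢ C₃ ×ˢ C₄ ×ˢ U, 0 < F z)
    (hNZ : ∀ z ∈ C₁ ×ˢ C₂ ×ˢ C₃ ×ˢ C₄ ×ˢ U, F z ≤ N)
    (hτ : ∀ m : ℕ, 0 < m → m ≤ N → #(m.divisors) ≤ Tm) :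
    #A₂ * #B₂ * #C₂ * #{t ∈ (A₁ ×ˢ A₂ ×ˢ A₃ ×ˢ A₄ ×ˢ R) ×ˢ ((B₁ ×ˢ B₂ ×ˢ B₃ ×ˢ B₄ ×ˢ S) ×ˢ
        (C₁ ×ˢ C₂ ×ˢ C₃ ×ˢ C₄ ×ˢ U)) | (F t.1 : ℤ) + F t.2.1 = F t.2.2} ^ 6 ≤
      27 * (Tm ^ 5) ^ 6 * (#(A₁ ×ˢ A₂ ×ˢ A₃ ×ˢ A₄ ×ˢ R) * #(B₁ ×ˢ B₂ ×ˢ B₃ ×ˢ B₄ ×ˢ S) *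
        #(C₁ ×ˢ C₂ ×ˢ C₃ ×ˢ C₄ ×ˢ U)) ^ 4 ∧
    #A₃ * #B₃ * #C₃ * #{t ∈ (A₁ ×ˢ A₂ ×ˢ A₃ ×ˢ A₄ ×ˢ R) ×ˢ ((B₁ ×ˢ B₂ ×ˢ B₃ ×ˢ B₄ ×ˢ S) ×ˢ
        (C₁ ×ˢ C₂ ×ˢ C₃ ×ˢ C₄ ×ˢ U)) | (F t.1 : ℤ) + F t.2.1 = F t.2.2} ^ 6 ≤
      27 * (Tm ^ 5) ^ 6 * (#(A₁ ×ˢ A₂ ×ˢ A₃ ×ˢ A₄ ×ˢ R) * #(B₁ ×ˢ B₂ ×ˢ B₃ ×ˢ B₄ ×ˢ S) *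
        #(C₁ ×ˢ C₂ ×ˢ C₃ ×ˢ C₄ ×ˢ U)) ^ 4 ∧
    #A₄ * #B₄ * #C₄ * #{t ∈ (A₁ ×ˢ A₂ ×ˢ A₃ ×ˢ A₄ ×ˢ R) ×ˢ ((B₁ ×ˢ B₂ ×ˢ B₃ ×ˢ B₄ ×ˢ S) ×ˢ
        (C₁ ×ˢ C₂ ×ˢ C₃ ×ˢ C₄ ×ˢ U)) | (F t.1 : ℤ) + F t.2.1 = F t.2.2} ^ 6 ≤
      27 * (Tm ^ 5) ^ 6 * (#(A₁ ×ˢ A₂ ×ˢ A₃ ×ˢ A₄ ×ˢ R) * #(B₁ ×ˢ B₂ ×ˢ B₃ ×ˢ B₄ ×ˢ S) *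
        #(C₁ ×ˢ C₂ ×ˢ C₃ ×ˢ C₄ ×ˢ U)) ^ 4 := by
  set 𝒳 := A₁ ×ˢ A₂ ×ˢ A₃ ×ˢ A₄ ×ˢ R with h𝒳
  set 𝒴 := B₁ ×ˢ B₂ ×ˢ B₃ ×ˢ B₄ ×ˢ S with h𝒴
  set 𝒵 := C₁ ×ˢ C₂ ×ˢ C₃ ×ˢ C₄ ×ˢ U with h𝒵
  have hT := card_solutions_pow_six_le 𝒳 𝒴 𝒵 (fun x => (F x : ℤ)) (fun y => (F y : ℤ))
    (fun z => (F z : ℤ))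
  have e2x := card_E2_shape_le 𝒳 F hF N Tm hposX hNX hτ
  have e2y := card_E2_shape_le 𝒴 F hF N Tm hposY hNY hτ
  have e2z := card_E2_shape_le 𝒵 F hF N Tm hposZ hNZ hτ
  refine ⟨?_, ?_, ?_⟩
  · exact pow_six_le_of_moments hT e2x e2y e2z
      (card_E4_shape_le_two A₁ A₂ A₃ A₄ R F hF N Tm hposX hNX hτ)
      (card_E4_shape_le_two B₁ B₂ B₃ B₄ S F hF N Tm hposY hNY hτ)
      (card_E4_shape_le_two C₁ C₂ C₃ C₄ U F hF N Tm hposZ hNZ hτ)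
  · exact pow_six_le_of_moments hT e2x e2y e2z
      (card_E4_shape_le_three A₁ A₂ A₃ A₄ R F hF N Tm hposX hNX hτ)
      (card_E4_shape_le_three B₁ B₂ B₃ B₄ S F hF N Tm hposY hNY hτ)
      (card_E4_shape_le_three C₁ C₂ C₃ C₄ U F hF N Tm hposZ hNZ hτ)
  · exact pow_six_le_of_moments hT e2x e2y e2z
      (card_E4_shape_le_four A₁ A₂ A₃ A₄ R F hF N Tm hposX hNX hτ)
      (card_E4_shape_le_four B₁ B₂ B₃ B₄ S F hF N Tm hposY hNY hτ)
      (card_E4_shape_le_four C₁ C₂ C₃ C₄ U F hF N Tm hposZ hNZ hτ)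

/-! ### The geometry bound for the shape map -/

/-- **Geometry bound for the shape map.** With dyadic first coordinates, the number of solutions
of `F x + F y = F z` (`x ∈ [X₁, 2X₁) × K_X`, `y ∈ [Y₁, 2Y₁) × K_Y`, `z ∈ [Z₁, 2Z₁) × K_Z`) with
`gcd(F x, F y) = 1` and `F z ≥ C` is at most `#K_X #K_Y #K_Z · (1 + 16 X₁Y₁Z₁ / C)`: fix the keys,
then `(x₁, y₁)` runs over coprime points of `{a₁x₁ + a₂y₁ ≡ 0 (mod D)}`, `D = F z / z₁ > C/(2Z₁)`,
counted by `card_lattice_box_coprime_le`. [cite: Bernert2025, Prop. 2] -/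
theorem card_coprimeSolutions_le (X₁ Y₁ Z₁ : ℕ) (hX₁ : 0 < X₁) (hY₁ : 0 < Y₁) (hZ₁ : 0 < Z₁)
    (KX KY KZ : Finset (ℕ × ℕ × ℕ × ℕ)) (F : ℕ × ℕ × ℕ × ℕ × ℕ → ℕ)
    (hF : ∀ x, F x = x.1 * x.2.1 ^ 2 * x.2.2.1 ^ 3 * x.2.2.2.1 ^ 4 * x.2.2.2.2) (C : ℕ)
    (hC : 0 < C) :
    (#{t ∈ (Ico X₁ (2 * X₁) ×ˢ KX) ×ˢ ((Ico Y₁ (2 * Y₁) ×ˢ KY) ×ˢ (Ico Z₁ (2 * Z₁) ×ˢ KZ)) |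
        F t.1 + F t.2.1 = F t.2.2 ∧ Nat.Coprime (F t.1) (F t.2.1) ∧ C ≤ F t.2.2} : ℝ) ≤
      #KX * #KY * #KZ * (1 + 16 * X₁ * Y₁ * Z₁ / C) := by
  classical
  set Sol := {t ∈ (Ico X₁ (2 * X₁) ×ˢ KX) ×ˢ ((Ico Y₁ (2 * Y₁) ×ˢ KY) ×ˢ (Ico Z₁ (2 * Z₁) ×ˢ KZ)) |
      F t.1 + F t.2.1 = F t.2.2 ∧ Nat.Coprime (F t.1) (F t.2.1) ∧ C ≤ F t.2.2} with hSol_def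
  set Q : ℕ × ℕ × ℕ × ℕ → ℕ := fun k => k.1 ^ 2 * k.2.1 ^ 3 * k.2.2.1 ^ 4 * k.2.2.2 with hQ_def
  have hFQ : ∀ x : ℕ × ℕ × ℕ × ℕ × ℕ, F x = x.1 * Q x.2 := fun x => by
    rw [hF]
    simp only [hQ_def]
    ring
  have memSol : ∀ t ∈ Sol, ((t.1.1 ∈ Ico X₁ (2 * X₁) ∧ t.1.2 ∈ KX) ∧
      (t.2.1.1 ∈ Ico Y₁ (2 * Y₁) ∧ t.2.1.2 ∈ KY) ∧ (t.2.2.1 ∈ Ico Z₁ (2 * Z₁) ∧ t.2.2.2 ∈ KZ)) ∧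
      F t.1 + F t.2.1 = F t.2.2 ∧ Nat.Coprime (F t.1) (F t.2.1) ∧ C ≤ F t.2.2 := by
    intro t ht
    simpa only [hSol_def, mem_filter, mem_product] using ht
  have hmaps : Set.MapsTo (fun t : (ℕ × ℕ × ℕ × ℕ × ℕ) × (ℕ × ℕ × ℕ × ℕ × ℕ) ×
      (ℕ × ℕ × ℕ × ℕ × ℕ) => (t.1.2, t.2.1.2, t.2.2.2))
      (Sol : Set ((ℕ × ℕ × ℕ × ℕ × ℕ) × (ℕ × ℕ × ℕ × ℕ × ℕ) × (ℕ × ℕ × ℕ × ℕ × ℕ)))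
      (KX ×ˢ KY ×ˢ KZ : Finset ((ℕ × ℕ × ℕ × ℕ) × (ℕ × ℕ × ℕ × ℕ) × (ℕ × ℕ × ℕ × ℕ))) := by
    intro t ht
    obtain ⟨⟨⟨-, h1⟩, ⟨-, h2⟩, ⟨-, h3⟩⟩, -⟩ := memSol t (Finset.mem_coe.mp ht)
    exact Finset.mem_coe.mpr (mem_product.mpr ⟨h1, mem_product.mpr ⟨h2, h3⟩⟩)
  have hbound : (0 : ℝ) ≤ 1 + 16 * X₁ * Y₁ * Z₁ / C := by positivity
  -- each fibre is a coprime lattice-point count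
  have hfib : ∀ k ∈ KX ×ˢ KY ×ˢ KZ,
      (#{t ∈ Sol | (t.1.2, t.2.1.2, t.2.2.2) = k} : ℝ) ≤ 1 + 16 * X₁ * Y₁ * Z₁ / C := by
    rintro ⟨k1, k2, k3⟩ -
    set Fk := {t ∈ Sol | (t.1.2, t.2.1.2, t.2.2.2) = (k1, k2, k3)} with hFk_def
    rcases Fk.eq_empty_or_nonempty with h0 | ⟨t₀, ht₀⟩
    · rw [h0, card_empty, Nat.cast_zero]
      exact hbound
    obtain ⟨ht₀S, hk₀⟩ := mem_filter.mp ht₀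
    obtain ⟨⟨⟨hx₀, -⟩, ⟨hy₀, -⟩, ⟨hz₀, -⟩⟩, heq₀, hcop₀, hC₀⟩ := memSol t₀ ht₀S
    simp only [Prod.mk.injEq] at hk₀
    obtain ⟨hk1, hk2, hk3⟩ := hk₀
    set a₁ := Q k1 with ha₁
    set a₂ := Q k2 with ha₂
    set D := Q k3 with hD_def
    have hFz₀ : F t₀.2.2 = t₀.2.2.1 * D := by rw [hFQ, hk3]
    have hFx₀ : F t₀.1 = t₀.1.1 * a₁ := by rw [hFQ, hk1]
    have hD : 0 < D := by
      refine Nat.pos_of_ne_zero (fun h0 => ?_)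
      rw [hFz₀, h0, mul_zero] at hC₀
      omega
    have hz₀' := (mem_Ico.mp hz₀).2
    have hDC : (C : ℝ) < 2 * Z₁ * D := by
      have h1 : C < 2 * Z₁ * D := by
        calc C ≤ t₀.2.2.1 * D := by rw [← hFz₀]; exact hC₀
          _ < 2 * Z₁ * D := Nat.mul_lt_mul_of_pos_right hz₀' hD
      exact_mod_cast h1
    have hcop : IsCoprime (a₁ : ℤ) (D : ℤ) := by
      rw [Nat.isCoprime_iff_coprime]
      have h1 : Nat.Coprime (F t₀.1) (F t₀.2.2) := by
        rw [← heq₀, add_comm]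
        exact Nat.coprime_add_self_right.mpr hcop₀
      rw [hFx₀, hFz₀] at h1
      exact (Nat.Coprime.coprime_mul_left h1).coprime_mul_left_right
    have hGN := card_lattice_box_coprime_le X₁ Y₁ D (a₁ : ℤ) (a₂ : ℤ) hX₁ hY₁ hD hcop
    have hinj : #Fk ≤ #{p ∈ Ico X₁ (2 * X₁) ×ˢ Ico Y₁ (2 * Y₁) |
        (D : ℤ) ∣ (a₁ : ℤ) * p.1 + (a₂ : ℤ) * p.2 ∧ Nat.Coprime p.1 p.2} := by
      refine card_le_card_of_injOn (fun t => (t.1.1, t.2.1.1)) (fun t ht => ?_)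
        (fun t ht t' ht' h => ?_)
      · obtain ⟨htS, hk⟩ := mem_filter.mp (Finset.mem_coe.mp ht)
        obtain ⟨⟨⟨hx, -⟩, ⟨hy, -⟩, ⟨hz, -⟩⟩, heq, hcp, -⟩ := memSol t htS
        simp only [Prod.mk.injEq] at hk
        obtain ⟨hk1', hk2', hk3'⟩ := hk
        have ex : F t.1 = t.1.1 * a₁ := by rw [hFQ, hk1']
        have ey : F t.2.1 = t.2.1.1 * a₂ := by rw [hFQ, hk2']
        have ez : F t.2.2 = t.2.2.1 * D := by rw [hFQ, hk3']
        simp only [coe_filter, mem_product, Set.mem_setOf_eq]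
        refine ⟨⟨hx, hy⟩, ?_, ?_⟩
        · refine ⟨(t.2.2.1 : ℤ), ?_⟩
          have : ((t.1.1 * a₁ + t.2.1.1 * a₂ : ℕ) : ℤ) = ((t.2.2.1 * D : ℕ) : ℤ) := by
            rw [← ex, ← ey, ← ez, heq]
          push_cast at this
          linear_combination this
        · rw [ex, ey] at hcp
          exact (Nat.Coprime.coprime_mul_right hcp).coprime_mul_right_right
      · obtain ⟨htS, hk⟩ := mem_filter.mp (Finset.mem_coe.mp ht)
        obtain ⟨htS', hk'⟩ := mem_filter.mp (Finset.mem_coe.mp ht')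
        obtain ⟨-, heq, -, -⟩ := memSol t htS
        obtain ⟨-, heq', -, -⟩ := memSol t' htS'
        simp only [Prod.mk.injEq] at hk hk' h
        obtain ⟨hk1', hk2', hk3'⟩ := hk
        obtain ⟨hk1'', hk2'', hk3''⟩ := hk'
        obtain ⟨h1, h2⟩ := h
        have e1 : t.1 = t'.1 := Prod.ext h1 (by rw [hk1', hk1''])
        have e2 : t.2.1 = t'.2.1 := Prod.ext h2 (by rw [hk2', hk2''])
        have ez : F t.2.2 = t.2.2.1 * D := by rw [hFQ, hk3']
        have ez' : F t'.2.2 = t'.2.2.1 * D := by rw [hFQ, hk3'']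
        have e3 : t.2.2.1 = t'.2.2.1 := by
          apply Nat.eq_of_mul_eq_mul_right hD
          rw [← ez, ← ez', ← heq, ← heq', e1, e2]
        exact Prod.ext e1 (Prod.ext e2 (Prod.ext e3 (by rw [hk3', hk3''])))
    have hDr : (0 : ℝ) < D := by exact_mod_cast hD
    have hCr : (0 : ℝ) < C := by exact_mod_cast hC
    calc (#Fk : ℝ) ≤ #{p ∈ Ico X₁ (2 * X₁) ×ˢ Ico Y₁ (2 * Y₁) |
          (D : ℤ) ∣ (a₁ : ℤ) * p.1 + (a₂ : ℤ) * p.2 ∧ Nat.Coprime p.1 p.2} := by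
          exact_mod_cast hinj
      _ ≤ 1 + 8 * X₁ * Y₁ / D := hGN
      _ ≤ 1 + 16 * X₁ * Y₁ * Z₁ / C := by
          have : (8 : ℝ) * X₁ * Y₁ / D ≤ 16 * X₁ * Y₁ * Z₁ / C := by
            rw [div_le_div_iff₀ hDr hCr]
            have hXY : (0 : ℝ) ≤ 8 * X₁ * Y₁ := by positivity
            nlinarith
          linarith
  rw [card_eq_sum_card_fiberwise hmaps]
  push_cast
  calc ∑ k ∈ KX ×ˢ KY ×ˢ KZ, (#{t ∈ Sol | (t.1.2, t.2.1.2, t.2.2.2) = k} : ℝ)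
      ≤ ∑ k ∈ KX ×ˢ KY ×ˢ KZ, (1 + 16 * (X₁ : ℝ) * Y₁ * Z₁ / C) := sum_le_sum hfib
    _ = #KX * #KY * #KZ * (1 + 16 * X₁ * Y₁ * Z₁ / C) := by
        rw [sum_const, nsmul_eq_mul, card_product, card_product]
        push_cast
        ring

end AbcExceptional

end Literature.NumberTheory.DiophantineGeometry
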